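import Summits.BirchSwinnertonDyer.BirchSwinnertonDyer.Theorems.SylvesterTwoHeegnerIndexCoupledDescentCebotarev
import HarnessLib

/-!
# Leaf (L3) of the coupled Kolyvagin descent — clause (b), the line of the bottom class

Sequel of `SylvesterTwoHeegnerIndexCoupledDescentCebotarev` (clause (a) `infinite_kolyvaginPrimes_ne`
and the per-curve bookkeeping); same crux (`UpperOffV0HSYPlus`, stmt-BirchSwinnertonDyer-19804),
same frame and displayed hypotheses. This file proves clause (b) — the `ceb_line` / `hL3b`
hypothesis of `SylvesterTwoCoupledDescent.selmerGroup_eq_bot_and_le_closure_of_coupledLeaves`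
(memo two §57.4 Step 8 (b)): for the bottom class `y` (in the application `δY`), a class `s` OFF
its `(ℤ/p)[w]`-line and `c ≠ 0` on the other curve, infinitely many Kolyvagin primes `ℓ` with
`y_λ = 0`, `s_λ ≠ 0`, `c_λ ≠ 0` — from the joint Galois element (`exists_h1Eval_eq_pair_of_comm`),
the pair Čebotarev step (`exists_kolyvaginPrime_gt_of_galoisElement_pair`, Čebotarev discharged by
`Automorphic.chebotarev_artinRep_holds`) and ONE extra displayed input on `y`: its `(ℤ/p)[w]`-line
is generated by a `σ`-FIXED class `x₁` (in the HSY frame: complex conjugation preserves `𝒪·δY`,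
memo two §64 (C4)/(h4′)). Generic (any two elliptic curves over `ℚ`, any imaginary quadratic `K`,
any prime `p ≠ 3`); nothing asserted about 19804; no definition, no named fact, no `sorry`; BSD
is not claimed.
-/

-- every Summits module is named `Summit.<Summit>.<Problem>…`: the duplicated component is by design
set_option linter.dupNamespace false

noncomputable section

open scoped Classical
open WeierstrassCurve NumberField IsDedekindDomain Field
open Literature.NumberTheory.EllipticCurves Literature.NumberTheory.GaloisRepresentations

universe u

namespace Summit.BirchSwinnertonDyer.BirchSwinnertonDyer.Theorems.SylvesterTwoCoupledDescentCebotarev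

variable {K : Type u} [Field K] [NumberField K]

section Main

variable {A B : WeierstrassCurve ℚ} [A.IsElliptic] [B.IsElliptic]

/-- **Leaf (L3), clause (b)** — the `ceb_line` / `hL3b` hypothesis of
`SylvesterTwoCoupledDescent.selmerGroup_eq_bot_and_le_closure_of_coupledLeaves`, PROVED from the
displayed data plus ONE input on the class `y` (the bottom class `δY` in the application):
its `(ℤ/p)[w]`-line is generated by a `σ`-FIXED class `x₁` (`y = α x₁ + β wH x₁` and
`a x₁ + b wH x₁ ∈ ℤy + ℤ wH y` for all `a, b`; in the HSY frame: complex conjugation preserves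
`𝒪·δY`, memo two §64 (C4)/(h4′)). Then for every class `s` OFF the line `{a y + b wH y}` and
every `c ≠ 0` in `H¹(K, A_K[p])` there are infinitely many Kolyvagin primes `ℓ` with `y_λ = 0`,
`s_λ ≠ 0`, `c_λ ≠ 0` at `λ ∋ ℓ`. Proof: family `(x₁ = y_{i₀}, …)` for `s` on `B`, an index
`j₁ ≠ i₀` where `s` has coefficients not both divisible by `p` (else `s ∈ (ℤ/p)[w] x₁ ⊆` line of
`y`), indicator target at `j₁` (so `[y, F] = 0`, `[s, F] ≠ 0`); family and target for `c` on `A`;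
joint `ρ`; pair Čebotarev step. Memo two §57.4 Step 8 (b).
[cite: McCallumLMS1991, §3 Cor. 3.2 (proof)] -/
theorem infinite_kolyvaginPrimes_line {NA NB : ℕ} [NeZero NA] [NeZero NB]
    (hK : IsImaginaryQuadratic K) {p : ℕ} (hp : p.Prime) (hp3 : p ≠ 3)
    {c : K ≃ₐ[ℚ] K} {c₀ : absoluteGaloisGroup ℚ} (hc₀ : IsComplexConjugation (Rat.castHom ℝ) c₀)
    (ht : IsLiftOfAut c (absGaloisTransport (K := ℚ) (L := K) c₀).toRingEquiv)
    -- data for `A`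
    (hSA : ∀ H : AddSubgroup (geomTorsion (A.baseChange K) p),
      (∀ g : absoluteGaloisGroup K, ∀ t ∈ H, g • t ∈ H) → H = ⊥ ∨ H = ⊤)
    (wA : geomTorsion (A.baseChange K) p →+ geomTorsion (A.baseChange K) p)
    (hw3A : ∀ P, wA (wA (wA P)) = P)
    (hCA : ∀ f : geomTorsion (A.baseChange K) p →+ geomTorsion (A.baseChange K) p,
      (∀ (g : absoluteGaloisGroup K) (t : geomTorsion (A.baseChange K) p), f (g • t) = g • f t) →
        ∃ a b : ℤ, ∀ t, f t = a • t + b • wA t)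
    (hcommA : ∀ (g h : absoluteGaloisGroup K) (P : geomTorsion (A.baseChange K) p),
      g • h • P = h • g • P)
    {zA₀ : absoluteGaloisGroup K}
    (ιA : geomTorsion (A.baseChange K) p →+ geomTorsion (A.baseChange K) p)
    (hιA : ∀ P, ιA (zA₀ • P - P) = P)
    (hιAg : ∀ (g : absoluteGaloisGroup K) (P : geomTorsion (A.baseChange K) p),
      ιA (g • P) = g • ιA P)
    (wHA : galH1Torsion (A.baseChange K) p →+ galH1Torsion (A.baseChange K) p)
    (hwH2A : ∀ x, wHA (wHA x) + wHA x + x = 0)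
    (hwHA : ∀ x, ∀ ρ ∈ torsionFixing (A.baseChange K) p,
      h1Eval (A.baseChange K) p (wHA x) ρ = wA (h1Eval (A.baseChange K) p x ρ))
    (hσwA : ∀ x, conjAct A c p (wHA x) = wHA (wHA (conjAct A c p x)))
    (hτwA : ∀ P, ht.torsionMap A p (wA P) = wA (wA (ht.torsionMap A p P)))
    {eA : ℕ} (hpowA : ∀ ρ : absoluteGaloisGroup K, ρ ^ eA ∈ torsionFixing (B.baseChange K) p)
    (heA : ∀ P : geomTorsion (A.baseChange K) p, eA • P = P)
    {zA : absoluteGaloisGroup K} (hzA : zA ∈ torsionFixing (B.baseChange K) p)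
    (hzAsurj : ∀ Q : geomTorsion (A.baseChange K) p,
      ∃ P : geomTorsion (A.baseChange K) p, zA • P - P = Q)
    (eA' : geomTorsion (A.baseChange K) p)
    (hindEA : ∀ a b : ℤ,
      a • (ht.torsionMap A p eA' + eA') + b • wA (ht.torsionMap A p eA' + eA') = 0 →
        (p : ℤ) ∣ a ∧ (p : ℤ) ∣ b)
    -- data for `B`
    (hSB : ∀ H : AddSubgroup (geomTorsion (B.baseChange K) p),
      (∀ g : absoluteGaloisGroup K, ∀ t ∈ H, g • t ∈ H) → H = ⊥ ∨ H = ⊤)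
    (wB : geomTorsion (B.baseChange K) p →+ geomTorsion (B.baseChange K) p)
    (hw3B : ∀ P, wB (wB (wB P)) = P)
    (hCB : ∀ f : geomTorsion (B.baseChange K) p →+ geomTorsion (B.baseChange K) p,
      (∀ (g : absoluteGaloisGroup K) (t : geomTorsion (B.baseChange K) p), f (g • t) = g • f t) →
        ∃ a b : ℤ, ∀ t, f t = a • t + b • wB t)
    (hcommB : ∀ (g h : absoluteGaloisGroup K) (P : geomTorsion (B.baseChange K) p),
      g • h • P = h • g • P)
    {zB₀ : absoluteGaloisGroup K}
    (ιB : geomTorsion (B.baseChange K) p →+ geomTorsion (B.baseChange K) p)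
    (hιB : ∀ P, ιB (zB₀ • P - P) = P)
    (hιBg : ∀ (g : absoluteGaloisGroup K) (P : geomTorsion (B.baseChange K) p),
      ιB (g • P) = g • ιB P)
    (wHB : galH1Torsion (B.baseChange K) p →+ galH1Torsion (B.baseChange K) p)
    (hwH2B : ∀ x, wHB (wHB x) + wHB x + x = 0)
    (hwHB : ∀ x, ∀ ρ ∈ torsionFixing (B.baseChange K) p,
      h1Eval (B.baseChange K) p (wHB x) ρ = wB (h1Eval (B.baseChange K) p x ρ))
    (hσwB : ∀ x, conjAct B c p (wHB x) = wHB (wHB (conjAct B c p x)))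
    (hτwB : ∀ P, ht.torsionMap B p (wB P) = wB (wB (ht.torsionMap B p P)))
    {eB : ℕ} (hpowB : ∀ ρ : absoluteGaloisGroup K, ρ ^ eB ∈ torsionFixing (A.baseChange K) p)
    (heB : ∀ P : geomTorsion (B.baseChange K) p, eB • P = P)
    {zB : absoluteGaloisGroup K} (hzB : zB ∈ torsionFixing (A.baseChange K) p)
    (hzBsurj : ∀ Q : geomTorsion (B.baseChange K) p,
      ∃ P : geomTorsion (B.baseChange K) p, zB • P - P = Q)
    (eB' : geomTorsion (B.baseChange K) p)
    (hindEB : ∀ a b : ℤ,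
      a • (ht.torsionMap B p eB' + eB') + b • wB (ht.torsionMap B p eB' + eB') = 0 →
        (p : ℤ) ∣ a ∧ (p : ℤ) ∣ b)
    -- the bottom class and its `σ`-fixed generator
    (y x₁ : galH1Torsion (B.baseChange K) p) (hx₁ : conjAct B c p x₁ = x₁)
    (hyx : ∃ α β : ℤ, y = α • x₁ + β • wHB x₁)
    (hxy : ∀ a b : ℤ, ∃ a' b' : ℤ, a • x₁ + b • wHB x₁ = a' • y + b' • wHB y)
    (s : galH1Torsion (B.baseChange K) p) (hs : ¬ ∃ a b : ℤ, s = a • y + b • wHB y)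
    (cl : galH1Torsion (A.baseChange K) p) (hcl : cl ≠ 0) :
    Set.Infinite {ℓ : ℕ | (ℓ.Prime ∧ ¬ ℓ ∣ NA ∧ ¬ ℓ ∣ NB ∧ ¬ ((ℓ : ℤ) ∣ NumberField.discr K) ∧
        ℓ ≠ p ∧ (Ideal.span {(ℓ : 𝓞 K)}).IsPrime ∧
        FrobEqFrobInfty A K p ℓ ∧ FrobEqFrobInfty B K p ℓ) ∧
      ∀ v : HeightOneSpectrum (𝓞 K), (ℓ : 𝓞 K) ∈ v.asIdeal →
        y ∈ (B.baseChange K).torsionLocalKer (v.adicCompletion K) p ∧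
        s ∉ (B.baseChange K).torsionLocalKer (v.adicCompletion K) p ∧
        cl ∉ (A.baseChange K).torsionLocalKer (v.adicCompletion K) p} := by
  have hinv : ∀ x, (absGaloisTransport (K := ℚ) (L := K) c₀).toRingEquiv
      ((absGaloisTransport (K := ℚ) (L := K) c₀).toRingEquiv x) = x := fun x ↦
    RatClosure.absGaloisTransport_absGaloisTransport_of_sq_eq_one hc₀.sq_eq_one x
  have hMB : ∀ x : galH1Torsion (B.baseChange K) p, (p : ℤ) • x = 0 :=
    zsmul_galH1Torsion_eq_zero _ _
  refine Set.infinite_of_forall_exists_gt fun b ↦ ?_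
  -- families: `(x₁, s)` on `B`, `cl` on `A`
  obtain ⟨r', ys, aS, bS, hys, hindB, hs_eq, hx₁mem⟩ :=
    exists_fixed_family B hK hp hp3 c wHB hwH2B hσwB x₁ s hx₁
  obtain ⟨r, xs, aC, bC, hxs, hindA, hc_eq, -⟩ :=
    exists_fixed_family A hK hp hp3 c wHA hwH2A hσwA 0 cl (map_zero _)
  -- targets on `B`: kill `y`, see `s`
  obtain ⟨aY, bY, vB, hy_eq, hyF, hsF⟩ : ∃ (aY bY : Fin r' → ℤ)
      (vB : Fin r' → geomTorsion (B.baseChange K) p),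
      y = ∑ j, (aY j • ys j + bY j • wHB (ys j)) ∧
      (∑ j, (aY j • (ht.torsionMap B p (vB j) + vB j) +
        bY j • wB (ht.torsionMap B p (vB j) + vB j))) = 0 ∧
      (∑ j, (aS j • (ht.torsionMap B p (vB j) + vB j) +
        bS j • wB (ht.torsionMap B p (vB j) + vB j))) ≠ 0 := by
    by_cases hx0 : x₁ = 0
    · -- then `y = 0` and `s ≠ 0`
      have hy0 : y = 0 := by
        obtain ⟨α, β, h⟩ := hyx
        rw [h, hx0]
        simp only [map_zero, zsmul_zero, add_zero]
      have hs0 : s ≠ 0 := fun h ↦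
        hs ⟨0, 0, by rw [h, hy0]; simp only [map_zero, zsmul_zero, add_zero]⟩
      obtain ⟨vB, hvB⟩ := exists_target_of_ne_zero B ht wB wHB eB' hindEB ys aS bS hs_eq
      refine ⟨fun _ ↦ 0, fun _ ↦ 0, vB, ?_, ?_, hvB hs0⟩
      · rw [hy0]
        exact (Finset.sum_eq_zero fun j _ ↦ by simp).symm
      · exact Finset.sum_eq_zero fun j _ ↦ by simp
    · obtain ⟨i₀, hi₀⟩ := hx₁mem hx0
      obtain ⟨α, β, hyαβ⟩ := hyx
      -- an index `j₁ ≠ i₀` where `s` is visible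
      obtain ⟨j₁, hj₁i, hj₁⟩ : ∃ j₁, j₁ ≠ i₀ ∧ ¬ ((p : ℤ) ∣ aS j₁ ∧ (p : ℤ) ∣ bS j₁) := by
        by_contra hcon
        push Not at hcon
        apply hs
        obtain ⟨a', b', hab⟩ := hxy (aS i₀) (bS i₀)
        refine ⟨a', b', ?_⟩
        rw [← hab, hs_eq, Finset.sum_eq_single i₀, hi₀]
        · intro j _ hj
          obtain ⟨⟨ka, hka⟩, ⟨kb, hkb⟩⟩ := hcon j hj
          rw [hka, hkb, mul_comm _ ka, mul_comm _ kb, mul_zsmul, mul_zsmul, hMB, hMB, zsmul_zero,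
            zsmul_zero, add_zero]
        · intro h
          exact absurd (Finset.mem_univ i₀) h
      refine ⟨fun j ↦ if j = i₀ then α else 0, fun j ↦ if j = i₀ then β else 0,
        fun j ↦ if j = j₁ then eB' else 0, ?_, ?_, ?_⟩
      · rw [hyαβ, Finset.sum_eq_single i₀]
        · simp [hi₀]
        · intro j _ hj
          simp [hj]
        · intro h
          exact absurd (Finset.mem_univ i₀) h
      · refine Finset.sum_eq_zero fun j _ ↦ ?_
        by_cases hj : j = i₀
        · have hj' : j ≠ j₁ := fun h ↦ hj₁i (h.symm.trans hj)
          simp [hj']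
        · simp [hj]
      · exact fun h ↦ hj₁ (hindEB _ _ ((sum_indicator_eq B ht wB aS bS j₁ eB').symm.trans h))
  -- target on `A`: see `cl`
  obtain ⟨vA, hvA⟩ := exists_target_of_ne_zero A ht wA wHA eA' hindEA xs aC bC hc_eq
  -- the joint Galois element
  obtain ⟨ρ, hρ, hρA, hρB⟩ := exists_h1Eval_eq_pair_of_comm (A.baseChange K) (B.baseChange K) hp
    hSA wA hCA hcommA ιA hιA hιAg wHA hwHA hpowA heA hzA hzAsurj
    hSB wB hCB hcommB ιB hιB hιBg wHB hwHB hpowB heB hzB hzBsurj xs hindA ys hindB vA vB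
  have hρTA : ρ ∈ torsionFixing (A.baseChange K) p := (Subgroup.mem_inf.mp hρ).1
  have hρTB : ρ ∈ torsionFixing (B.baseChange K) p := (Subgroup.mem_inf.mp hρ).2
  -- the Kolyvagin prime
  obtain ⟨ℓ, hbℓ, hℓ, hℓNA, hℓNB, hℓD, hℓp, hprime, hfrobA, hfrobB, m, hmA, hmB, hlocA, hlocB⟩ :=
    exists_kolyvaginPrime_gt_of_galoisElement_pair_prime (NA := NA) (NB := NB)
      (Literature.NumberTheory.Automorphic.chebotarev_artinRep_holds) hK hp hc₀ ht hinv
      (Sum.elim xs (wHA ∘ xs)) (Sum.elim ys (wHB ∘ ys)) hρTA hρTB b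
  refine ⟨ℓ, ⟨⟨hℓ, hℓNA, hℓNB, hℓD, hℓp, hprime, hfrobA, hfrobB⟩, fun v hv ↦ ⟨?_, ?_, ?_⟩⟩, hbℓ⟩
  · -- `y_λ = 0`
    refine (hlocB y (hy_eq ▸ sum_mem_closure_range B wHB ys aY bY) v hv).mpr ?_
    rw [hy_eq, h1Eval_sum_conj_mul_eq B ht hinv wB hw3B wHB hwHB hσwB hτwB hys hρTB vB hρB hmB aY bY]
    exact hyF
  · -- `s_λ ≠ 0`
    intro hmem
    apply hsF
    rw [← h1Eval_sum_conj_mul_eq B ht hinv wB hw3B wHB hwHB hσwB hτwB hys hρTB vB hρB hmB aS bS,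
      ← hs_eq]
    exact (hlocB s (hs_eq ▸ sum_mem_closure_range B wHB ys aS bS) v hv).mp hmem
  · -- `cl_λ ≠ 0`
    intro hmem
    apply hvA hcl
    rw [← h1Eval_sum_conj_mul_eq A ht hinv wA hw3A wHA hwHA hσwA hτwA hxs hρTA vA hρA hmA aC bC,
      ← hc_eq]
    exact (hlocA cl (hc_eq ▸ sum_mem_closure_range A wHA xs aC bC) v hv).mp hmem


end Main

end Summit.BirchSwinnertonDyer.BirchSwinnertonDyer.Theorems.SylvesterTwoCoupledDescentCebotarev

end
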